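import Literature.NumberTheory.Automorphic.RankinSelbergTowerFiniteness
import Literature.NumberTheory.Automorphic.SummableNormSqTraceSatakePowOfTorusFiniteness
import Literature.NumberTheory.Automorphic.GodementJacquetPartialL
import HarnessLib

/-!
# Jacquet–Shalika: `L^S(s, Π)` is holomorphic on `re s > 1` — the discharge

Topic `NumberTheory/Automorphic`; namespace `Literature.NumberTheory.Automorphic`. Proof file
(theorems only: no definition, no named fact, no instance), the leaf closing the named fact
`JacquetShalika1981_differentiableOn_partialStandardL` of `GodementJacquetPartialL`:

> H. Jacquet, J. A. Shalika, *On Euler products and the classification of automorphic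
> representations I*, Amer. J. Math. **103** (1981), Thm. (5.3) p. 555 with Remark (5.4) p. 557
> (case `p = 1`, `π' = 1`): for a (unitary) cuspidal automorphic representation `π` of `GL_n(𝔸_K)`
> the Euler product `L_S(s, π)` is absolutely convergent in the half-plane `Re(s) > 1`;

hence (normal convergence on every `re s > σ₁ > 1`) the partial standard `L`-function
`L^S(s, Π) = ∏_{v ∉ S} ∏_{a ∈ α v} (1 - a q_v^{-s})⁻¹` of an honest Satake family `α` of `Π` off any
finite `S` is holomorphic on `re s > 1`.

**The proof in the tree.** `GodementJacquetPartialL` reduces the fact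
(`JacquetShalika1981_differentiableOn_partialStandardL_of_summable`, Weierstrass: locally uniform
convergence of the Euler product, and non-vanishing of the local factors by (5.1.3)) to the single
Jacquet–Shalika input `summable_normSq_trace_satakePow` of `AutomorphicLFunctionProofs` — the
series (5.3.3) `∑_{v ∉ S} ∑_{k ≥ 1} |tr A_v^k|² / (k q_v^{kσ})` converges for `σ > 1` ((5.3.4),
loc. cit. p. 556), off an *arbitrary* finite `S`. That input is obtained here, in every rank `n` and
over every number field `K`, from the real-point Rankin–Selberg method of the tree: the reduction
`summable_normSq_trace_satakePow_of_rankinSelbergTorusIntegral_ne_top`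
(`SummableNormSqTraceSatakePowOfTorusFiniteness`: the single-place run of the unfolded integral,
genericity of cusp forms, test vectors of prescribed level, positivity of the unit-box integral and
Shintani's formula for the unramified torus sums, Cauchy's identity) fed with the finiteness theorem
`rankinSelbergTorusIntegral_whittakerCoeff_ne_top` (`RankinSelbergTowerFiniteness`: the unfolded
Rankin–Selberg integral `Ψ(σ; W_φ, W̄_φ, e^{-‖·_∞‖} ⊗ 𝟙_{𝒪̂ⁿ})` of the Whittaker coefficient of a
smoothed `L²` cusp form is finite for `σ > 1` — the Whittaker tower, reduction theory, rapid decay),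
for Haar measures on `(𝔸_Kˣ)ⁿ`, on `K_∞ GL_n(𝒪̂_K)` and on `N_n(𝔸_K)`, exactly as in
`JacquetShalika1981_schurSelfSum_prod_bounded_holds` (loc. cit.). Ranks `n ≤ 2` were unconditional
before (`GodementJacquetPartialLGL2`), `n ≤ 3` conditional on Lemma (5.2) alone
(`SatakeParameterHeckeBound`); the present theorem covers every rank.

* `JacquetShalika1981_differentiableOn_partialStandardL_holds` — **the named fact is a theorem**
  (axioms `propext`, `Classical.choice`, `Quot.sound`).

## References

* H. Jacquet, J. A. Shalika, *On Euler products and the classification of automorphic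
  representations I*, Amer. J. Math. 103 (1981), 499–558: (5.1.3) p. 554, Lemma (5.2) p. 554,
  Thm. (5.3) p. 555, its proof (5.3.3)–(5.3.4) p. 556, Remark (5.4) p. 557 [JacquetShalikaAJM1981].
* J. W. Cogdell, *Analytic theory of L-functions for GL_n*, in: J. Bernstein, S. Gelbart (eds.),
  *An Introduction to the Langlands Program*, Birkhäuser (2004), §2.3, §4.1
  [CogdellAnalyticTheory2004].
-/

noncomputable section

open MeasureTheory Measure NumberField IsDedekindDomain
open scoped MatrixGroups
open Literature.NumberTheory.GaloisRepresentations (ideleGroup)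

namespace Literature.NumberTheory.Automorphic

section Discharge

variable {n : ℕ} {K : Type} [Field K] [NumberField K]
  {μ : Measure (AdelicGroupData.gl n K).automorphicQuotient}
  [(AdelicGroupData.gl n K).IsAutomorphicMeasure μ]

-- Borel structures as in `JacquetShalikaSchurSelfSumOfTorusFiniteness` / `RankinSelbergTowerFiniteness`
-- (local instances, all `borel _`; nothing in Mathlib is overridden).
attribute [local instance] adelicBorel borelSpace_adelic locallyCompactSpace_adelic
  secondCountableTopology_gl_adelic glAdeleBorel borelSpace_glAdele

/-- **Jacquet–Shalika's (5.3.3)–(5.3.4) off an arbitrary finite set of places, in every rank** — the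
statement `summable_normSq_trace_satakePow` of `AutomorphicLFunctionProofs`, obtained by feeding the
finiteness of the unfolded Rankin–Selberg integral (`rankinSelbergTorusIntegral_whittakerCoeff_ne_top`,
Haar measures, the test function `e^{-‖·_∞‖} ⊗ 𝟙_{𝒪̂ⁿ}`) into the single-place reduction
`summable_normSq_trace_satakePow_of_rankinSelbergTorusIntegral_ne_top`; rank `0` by
`summable_normSq_trace_satakePow_of_le_one`. (A private auxiliary of this leaf: the tree's own
discharge `summable_normSq_trace_satakePow_holds` belongs with the proof files of
`AutomorphicLFunctionProofs`.)
[cite: JacquetShalikaAJM1981, Thm. (5.3), proof, (5.3.3)–(5.3.4) p. 556; (5.1.3) p. 554] -/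
private theorem summable_normSq_trace_satakePow_of_towerFiniteness :
    summable_normSq_trace_satakePow (n := n) (K := K) (μ := μ) := by
  rcases Nat.eq_zero_or_pos n with hn0 | hn
  · exact summable_normSq_trace_satakePow_of_le_one (by omega)
  letI : MeasurableSpace (ideleGroup K) := borel _
  haveI : BorelSpace (ideleGroup K) := ⟨rfl⟩
  haveI := locallyCompactSpace_ideleGroup K
  haveI := secondCountableTopology_ideleGroup K
  haveI : T2Space (GL (Fin n) (AdeleRing (𝓞 K) K)) := t2Space_gl n K
  haveI : LocallyCompactSpace (GL (Fin n) (AdeleRing (𝓞 K) K)) :=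
    AdelicGroupData.locallyCompactSpace_generalLinearGroup_adeleRing K (Fin n)
  haveI : CompactSpace ↥(maximalCompactAdelic n K) :=
    isCompact_iff_compactSpace.1 (isCompact_maximalCompactAdelic n K)
  haveI : LocallyCompactSpace ↥(adelicUnipotent n K) :=
    (isClosed_adelicUnipotent n K).locallyCompactSpace
  set νA : Measure (Fin n → ideleGroup K) := Measure.haar with hνA
  set νK : Measure ↥(maximalCompactAdelic n K) := Measure.haar with hνK
  set ν₀ : Measure ↥(adelicUnipotent n K) := Measure.haar with hν₀
  exact summable_normSq_trace_satakePow_of_rankinSelbergTorusIntegral_ne_top νA νK ν₀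
    (continuous_jsArchTestFun n K) (jsArchTestFun_pos n K)
    (fun η hη f hf σ hσ => rankinSelbergTorusIntegral_whittakerCoeff_ne_top hn νA νK ν₀ hη hf hσ)

/-- **Jacquet–Shalika (1981), Thm. (5.3) with Remark (5.4): `L^S(s, Π)` is holomorphic on
`re s > 1`** — the named fact `JacquetShalika1981_differentiableOn_partialStandardL` of
`GodementJacquetPartialL` is a theorem: for every (unitary) cuspidal automorphic representation `Π`
of `GL_n(𝔸_K)` (any `n`, any number field `K`), every finite set `S` of finite places and every
Satake family `α` of `Π` off `S`, the partial standard `L`-function `partialStandardL ↑S α` is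
holomorphic on `{s | 1 < re s}`. From `summable_normSq_trace_satakePow_of_towerFiniteness` by
`JacquetShalika1981_differentiableOn_partialStandardL_of_summable` (normal convergence of the Euler
product on every half-plane `re s > σ₁ > 1`).
[cite: JacquetShalikaAJM1981, Thm. (5.3) p. 555, Remark (5.4) p. 557; proof (5.3.3)–(5.3.4) p. 556] -/
theorem JacquetShalika1981_differentiableOn_partialStandardL_holds :
    JacquetShalika1981_differentiableOn_partialStandardL (n := n) (K := K) (μ := μ) :=
  JacquetShalika1981_differentiableOn_partialStandardL_of_summable
    summable_normSq_trace_satakePow_of_towerFiniteness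

end Discharge

end Literature.NumberTheory.Automorphic
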